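import Literature.Combinatorics.Additive.StevensDeZeeuwIncidence
import Literature.Combinatorics.Extremal.FlecnodePolynomial
import Literature.Combinatorics.Extremal.LineIntersectionsOnSurface
import HarnessLib

/-!
# Stevens–de Zeeuw's Theorem 4: reduction to Kollár's Propositions 14 (2) and 55

Topic `Literature/Combinatorics/Additive`. Theorems only (no definition, no named fact). The
named fact `Literature.Combinatorics.Additive.stevensDeZeeuw_thm4` [StevensDeZeeuw2017, Thm. 4]
was reduced in the tree (de Zeeuw 2016, Rudnev 2018, Guth–Katz–Kollár) to three inputs about a
single irreducible surface `{f = 0} ⊂ K³`, `K` algebraically closed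
(`Literature.Combinatorics.Extremal.stevensDeZeeuw_thm4_of_kollar_generic'`): `H13` (a surface of
degree `≤ c·d` through all lines of a non-ruled surface), `H14` (Kollár's genus count on complete
intersections, [Kollar2015, Prop. 14 (2)]) and `H55` (lines on ruled surfaces,
[Kollar2015, Prop. 55]). `H13` with `c = 39` is now a theorem
(`Literature.Combinatorics.Extremal.exists_vanishing_on_lines_of_not_generically_ruled`, the
elementary Monge–Salmon–Cayley theorem of `FlecnodePolynomial.lean`), so Theorem 4 follows from
`H14` and `H55` alone: `stevensDeZeeuw_thm4_of_H14_H55`.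

## References
* [StevensDeZeeuw2017] S. Stevens, F. de Zeeuw, *An improved point-line incidence bound over
  arbitrary fields*, Bull. LMS 49 (2017), Theorem 4.
* [Kollar2015] J. Kollár, *Szemerédi–Trotter-type theorems in dimension 3*, Adv. Math. 271
  (2015), Theorem 13, Proposition 14, Proposition 55.
-/

namespace Literature.Combinatorics.Additive

open MvPolynomial Literature.Combinatorics.Extremal

open scoped Classical in
/-- **Stevens–de Zeeuw's Theorem 4 from Kollár's Propositions 14 (2) and 55.** With Theorem 13
(generic form, constant `39`) now proved (`exists_vanishing_on_lines_of_not_generically_ruled`),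
the incidence bound [StevensDeZeeuw2017, Thm. 4] follows from the two remaining classical
inputs: `H14`, the arithmetic-genus count of singular points on the complete intersection
`{f = g = 0}` [Kollar2015, Prop. 14 (2)], and `H55`, the structure of lines on generically
ruled surfaces [Kollar2015, Prop. 55] (generic form). [cite: StevensDeZeeuw2017, Theorem 4;
Kollar2015, Thm. 13, Prop. 14, Prop. 55] -/
theorem stevensDeZeeuw_thm4_of_H14_H55
    (H14 : ∀ (K : Type) [Field K] [IsAlgClosed K] (f g : MvPolynomial (Fin 3) K),
      Irreducible f → ¬ f ∣ g →
      ∀ Λ : Finset (AffineSubspace K (Fin 3 → K)),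
        (∀ ℓ ∈ Λ, Module.finrank K ℓ.direction = 1) →
        (∀ ℓ ∈ Λ, ∀ q ∈ ℓ, eval q f = 0) → (∀ ℓ ∈ Λ, ∀ q ∈ ℓ, eval q g = 0) →
        ∀ P : Finset (Fin 3 → K), (∀ p ∈ P, ∃ ℓ ∈ Λ, p ∈ ℓ) →
          (∑ p ∈ P, (((Λ.filter fun ℓ => p ∈ ℓ).card : ℝ) - 1)) ≤
            (1 / 2 : ℝ) * f.totalDegree * g.totalDegree *
              ((f.totalDegree : ℝ) + g.totalDegree - 2))
    (H55 : ∀ (K : Type) [Field K] [IsAlgClosed K] (f : MvPolynomial (Fin 3) K),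
      Irreducible f → 3 ≤ f.totalDegree →
      (∃ h : MvPolynomial (Fin 3) K, ¬ f ∣ h ∧ ∀ p : Fin 3 → K, eval p f = 0 →
          eval p h ≠ 0 → ∃ ℓ : AffineSubspace K (Fin 3 → K),
            Module.finrank K ℓ.direction = 1 ∧ p ∈ ℓ ∧ ∀ q ∈ ℓ, eval q f = 0) →
      (¬ ∃ p : Fin 3 → K, (translate p f).IsHomogeneous f.totalDegree) →
      (¬ ∃ v : Fin 3 → K, v ≠ 0 ∧ ∀ (p : Fin 3 → K) (t : K), eval (p + t • v) f = eval p f) →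
      ∃ E : Finset (AffineSubspace K (Fin 3 → K)), E.card ≤ 2 ∧
        ∀ ℓ : AffineSubspace K (Fin 3 → K), Module.finrank K ℓ.direction = 1 →
          (∀ q ∈ ℓ, eval q f = 0) → ℓ ∉ E →
          ∀ P : Finset (Fin 3 → K),
            (∀ p ∈ P, p ∈ ℓ ∧ ∃ ℓ' : AffineSubspace K (Fin 3 → K),
                Module.finrank K ℓ'.direction = 1 ∧ (∀ q ∈ ℓ', eval q f = 0) ∧
                ℓ' ≠ ℓ ∧ ℓ' ∉ E ∧ p ∈ ℓ') →
            P.card + 2 ≤ f.totalDegree) :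
    Literature.Combinatorics.Additive.stevensDeZeeuw_thm4 :=
  stevensDeZeeuw_thm4_of_kollar_generic' 39 (by norm_num)
    (fun _ _ _ _ hf hd hchar hngr =>
      exists_vanishing_on_lines_of_not_generically_ruled hf hd hchar hngr) H14 H55


end Literature.Combinatorics.Additive
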